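import Summits.QuantumFields.YangMills.Theorems.BalabanUVNodesPortS1LZdetTwinDefs
import Summits.QuantumFields.YangMills.Theorems.BalabanUVNodesPortS1JacPiecesDefs

/-!
# NODE O port PT-A — OBJECTS OF THE INTEGER TWIN OF THE (63) POWER MEMBER (`stub_LZdetTwin : ∀ F, PowMemberIntTwin F` of 27930, line `pta_residueW`): the NON-CENTRAL INTEGER BOND INDEX
# of an integer cube set `X̂`, the integer piece matrices `TZY Ŷ f` read on that index, and the integer power-member formula `powTwin … X̂ f` — ✓`powMemberPiece` over the sub-cube-sets `Ŷ ⊆ X̂`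

Cell `ym-nodeO-ideate`, porter seat `ymgap-nodeO-port-PTA-1` (gen 8); DEFINITION file (objects the line posits), `--supports stmt-QuantumFields-27930`.  [I] = [Balaban1987RG1], [16] = [Balaban1985UV3].
Over DEF-1 ed.13∕ed.23 (`IntBondCfg`, `IntFormula`, the integer pieces `TZY X̂ f (b̂ᵢ, a) (b̂ⱼ, a′)` of `P0CarrierClauses` on level-`k` integer bonds × colour) and gen 6's ✓`…JacPiecesDefs` (`centralBondZ`,
`embZ`, `coverBondAt`), ✓`…LocPowSeries` (`powMemberPiece`).
* `IsCentralZ L b̂` — the integer level-`k` bond `b̂` is the central bond `b₀(ĉ)` of the integer coarse bond `ĉ = (⌊b̂₋∕L⌋, μ)` through its block (the bonds eliminated by the δ-functions, [I] p.267;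
  twin of `recordB0 = centralBond`).
* `twinBonds F Mc X̂` — the non-central integer level-`k` bonds whose source lies in an `L·Mc`-block of `X̂` (the integer reading of the non-b₀ fluctuation index with cube in `X`);
  `TwinIdx F Mc X̂ := Fin 3 × ↥(twinBonds F Mc X̂)` (colour × bond).
* `twinMat F Mc TZY X̂ Ŷ f` — the integer piece of `Ŷ` read as a matrix on `TwinIdx F Mc X̂`.
* ★ `powTwin F Mc TZY R : IntFormula` — `(X̂, f) ↦ powMemberPiece (Ŷ ↦ Ŷ) (Ŷ ↦ twinMat … X̂ Ŷ f) R X̂` over `Ŷ ∈ 𝒫(X̂)` — the candidate integer twin of the power member (its window-locality,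
  `SL(2,ℂ)`-invariance and cover bridge = companion proof files `…LZdetTwinLocal` ∕ `…LZdetTwinBridge`).

HONEST FRAMING.  Definitions only; NOTHING of Bałaban asserted or proved; whether `powTwin` witnesses `PowMemberIntTwin` is the content of the companion proof files; `stub_LZdetTwin` ∕ `stub_P0C` ∕
`stub_G3C` ∕ `stub_FE` OPEN; 27930 OPEN · no claim; NODE O 0∕1; COUNT 8∕28 · K 1∕4 UNMOVED; finite `𝕋⁴_{L^K}` at fixed ε — NOT continuum ∕ OS ∕ Clay; **the Yang–Mills mass gap is NOT proved
by any of this.**  No `sorry`, no `instance`, no `notation`; standard axioms.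
-/

noncomputable section

open scoped BigOperators Matrix.Norms.L2Operator

namespace Summit.QuantumFields.YangMills.Theorems.BalabanUVNodesPortS1

open Summit.QuantumFields.YangMills.Theorems.K0RecordFormatNames
open Literature.MathematicalPhysics.QuantumFieldTheory.Balaban1983to89
open Literature.MathematicalPhysics.QuantumFieldTheory.Balaban1983to89.Node00
open Literature.MathematicalPhysics.QuantumFieldTheory.Balaban1983to89.T4Continuum (T4Family)
open Literature.MathematicalPhysics.QuantumLattice (blockMap blockSites)

/-- **The integer level-`k` bond `b̂` IS A CENTRAL BOND**: `b̂ = b₀(ĉ)` for the integer coarse bond `ĉ := (⌊b̂₋ ∕ L⌋, μ)` of its block (twin of `recordB0 = centralBond`; the variables `B′(b₀(c))`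
eliminated by the δ-functions). [cite: Balaban1987RG1, p.267 («we eliminate the variables B′(b₀(c))»), (0.1) p.252] -/
def IsCentralZ (L : ℕ) (b : (Fin 4 → ℤ) × Fin 4) : Prop := centralBondZ L (blockMap L b.1, b.2) = b

open scoped Classical in
/-- **The non-central integer bonds of `X̂`**: integer level-`k` bonds `(ẑ, μ)` with `⌊ẑ ∕ (L·Mc)⌋ ∈ X̂` (the source lies in an `Mc`-cube of `X̂` at level `k + 1`) that are not central — the integer
reading of the non-b₀ fluctuation indices with cube in `X`. [cite: Balaban1987RG1, (2.11) p.267, p.257, (1.21) p.264] -/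
def twinBonds (F : T4Family) (Mc : ℕ) (Xh : Finset (Fin 4 → ℤ)) : Finset ((Fin 4 → ℤ) × Fin 4) :=
  ((Xh.biUnion fun a => blockSites (F.L * Mc) a) ×ˢ (Finset.univ : Finset (Fin 4))).filter fun b => ¬ IsCentralZ F.L b

/-- **The integer fluctuation index of `X̂`**: colour × non-central integer bond of `X̂`. [cite: Balaban1987RG1, (2.11) p.267 (bookkeeping)] -/
abbrev TwinIdx (F : T4Family) (Mc : ℕ) (Xh : Finset (Fin 4 → ℤ)) : Type := Fin 3 × ↥(twinBonds F Mc Xh)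

/-- **The integer piece of `Ŷ` as a matrix on the integer fluctuation index of `X̂`**: entries `TZY Ŷ f (b̂, a) (b̂′, a′)`. [cite: Balaban1987RG1, (1.21) p.264, (2.11) p.267] -/
def twinMat (F : T4Family) (Mc : ℕ) (TZY : Finset (Fin 4 → ℤ) → IntBondCfg → ((Fin 4 → ℤ) × Fin 4) × Fin 3 → ((Fin 4 → ℤ) × Fin 4) × Fin 3 → ℂ)
    (Xh Yh : Finset (Fin 4 → ℤ)) (f : IntBondCfg) : Matrix (TwinIdx F Mc Xh) (TwinIdx F Mc Xh) ℂ :=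
  Matrix.of fun i j => TZY Yh f (i.2.1, i.1) (j.2.1, j.1)

open scoped Classical in
/-- ★ **THE INTEGER POWER-MEMBER FORMULA `powTwin`**: `(X̂, f) ↦ Σ_{n ≥ 1} ((−1)ⁿ∕2n) R⁻ⁿ · (piece of X̂ in Tr (Σ_{Ŷ ⊆ X̂} TZ_Ŷ(f))ⁿ, localized)` — ✓`powMemberPiece` over the sub-cube-sets `Ŷ ∈ 𝒫(X̂)`
with supports `Ŷ` and matrices `twinMat … X̂ Ŷ f`; the candidate witness of `PowMemberIntTwin`. [cite: Balaban1985UV3, (63) p.272; Balaban1987RG1, (1.21) p.264, (1.7) p.261] -/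
def powTwin (F : T4Family) (Mc : ℕ) (TZY : Finset (Fin 4 → ℤ) → IntBondCfg → ((Fin 4 → ℤ) × Fin 4) × Fin 3 → ((Fin 4 → ℤ) × Fin 4) × Fin 3 → ℂ) (R : ℝ) :
    IntFormula :=
  fun Xh f => powMemberPiece (fun Yh : ↥Xh.powerset => (Yh.1 : Finset (Fin 4 → ℤ))) (fun Yh => twinMat F Mc TZY Xh Yh.1 f) R Xh

end Summit.QuantumFields.YangMills.Theorems.BalabanUVNodesPortS1

end
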